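import Mathlib.Analysis.SpecialFunctions.Log.Basic
import Mathlib.Dynamics.Ergodic.MeasurePreserving
import Mathlib.MeasureTheory.Integral.Bochner.Basic

/-!
# Contact-asymmetry kernel for the crux `LocalSecondLaw` (stmt-AtomisticToContinuum-13081),
line `contact-asymmetry-information`

Theorems-side copy (texts byte-identical, only the namespace differs) of the ABSTRACT KERNEL of the registered skeleton
`Cruxes/LocalSecondLaw/Lines/contact_asymmetry_information.lean` (§ Kernel), so that stub proofs under `Theorems/` and the
lead's reshaped skeleton share one vocabulary: on a measure space `(X, μ)` with a `μ`-preserving measurable involution `J`,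
the booked surprisal production `bookedProduction μ J q b = ∫ q (log b − log b∘J)`, the `J`-asymmetry information
`asymmetryInfo μ J q = KL(QJ‖Q)`, the odd log-correlation term, the pointwise Jeffreys integrand, and the identities /
inequalities `bookedProduction = asymmetryInfo + oddLogCorrelation`, `∫ jeffreys = 2·asymmetryInfo`,
`oddLogCorrelation = ∫ (qJ − q)·ψ_odd`, the Gibbs sign from the a.e. condition, and the two consequences of pointwise
one-sided relative odd chaos (`bookedProduction_ge_of_pointwise`, `asymmetryInfo_le_of_pointwise`).

References: S. Kullback, *Information Theory and Statistics* (1959), Ch. 2 (KL and Jeffreys divergences);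
H. Spohn, *Large Scale Dynamics of Interacting Particles* (1991), Part I §3 (setting).  Lead seat
prover-line-stmt-AtomisticToContinuum-13081-a5-0 (vocabulary landing; mathematics by the crux-plan seat of the line).
-/

noncomputable section

open scoped BigOperators Topology Classical MeasureTheory ENNReal
open Filter Set MeasureTheory Function

namespace Summit.AtomisticToContinuum.HydrodynamicLimit.Theorems.LocalSecondLawContact

section Kernel

variable {X : Type*} [MeasurableSpace X]

/-- Booked surprisal production of the reference density `b` under the law of density `q`: `E_Q[log b − log (b ∘ J)]`. -/
def bookedProduction (μ : Measure X) (J : X → X) (q b : X → ℝ) : ℝ :=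
  ∫ x, q x * (Real.log (b x) - Real.log (b (J x))) ∂μ

/-- J-asymmetry information `KL(QJ ‖ Q) = ∫ (q ∘ J) (log (q ∘ J) − log q)` (the ARROW-OF-TIME information of the
contact law: how distinguishable time-reversed outgoing pairs are from incoming ones). -/
def asymmetryInfo (μ : Measure X) (J : X → X) (q : X → ℝ) : ℝ :=
  ∫ x, q (J x) * (Real.log (q (J x)) - Real.log (q x)) ∂μ

/-- Odd log-correlation term `∫ (q ∘ J − q) (log q − log b)` (the `Q`-mean of minus twice the J-odd part of the log
pair-correlation `log (q/b)`). -/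
def oddLogCorrelation (μ : Measure X) (J : X → X) (q b : X → ℝ) : ℝ :=
  ∫ x, (q (J x) - q x) * (Real.log (q x) - Real.log (b x)) ∂μ

/-- The pointwise Jeffreys integrand `(q∘J − q)(log q∘J − log q)` — non-negative wherever `q`, `q∘J` are both positive or
both zero; its integral is TWICE the asymmetry information (`integral_jeffreysIntegrand`). -/
def jeffreysIntegrand (J : X → X) (q : X → ℝ) (x : X) : ℝ :=
  (q (J x) - q x) * (Real.log (q (J x)) - Real.log (q x))

/-- The log pair-correlation `ψ = log q − log b` (up to J-even terms: `log g₂`). -/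
def logCorr (q b : X → ℝ) (x : X) : ℝ := Real.log (q x) - Real.log (b x)

/-- J-odd part of a function, `g_odd = (g − g ∘ J)/2`. -/
def oddPart (J : X → X) (g : X → ℝ) (x : X) : ℝ := (g x - g (J x)) / 2

variable {μ : Measure X} {J : X → X} {q b : X → ℝ}

/-- **The booked production is J-asymmetry information plus the odd log-correlation term** (exact; change of variables
under the `μ`-preserving involution `J`). [IdeatorFiveSketch, re-derived] -/
theorem bookedProduction_eq_asymmetryInfo_add_oddLogCorrelation
    (hJ : MeasurePreserving J μ μ) (hJJ : Involutive J)
    (h1 : Integrable (fun x => q x * Real.log (q x)) μ)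
    (h2 : Integrable (fun x => q x * Real.log (b x)) μ)
    (h3 : Integrable (fun x => q (J x) * Real.log (q x)) μ)
    (h4 : Integrable (fun x => q (J x) * Real.log (b x)) μ) :
    bookedProduction μ J q b = asymmetryInfo μ J q + oddLogCorrelation μ J q b := by
  have hJ2 : ∀ x, J (J x) = x := hJJ
  have hemb : MeasurableEmbedding J :=
    (MeasurableEquiv.ofInvolutive J hJJ hJ.measurable).measurableEmbedding
  have T1 : ∫ x, q (J x) * Real.log (q (J x)) ∂μ = ∫ x, q x * Real.log (q x) ∂μ :=
    hJ.integral_comp hemb (fun x => q x * Real.log (q x))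
  have T2 : ∫ x, q x * Real.log (b (J x)) ∂μ = ∫ x, q (J x) * Real.log (b x) ∂μ := by
    have h := hJ.integral_comp hemb (fun x => q (J x) * Real.log (b x))
    simp only [hJ2] at h
    exact h
  have i1 : Integrable (fun x => q (J x) * Real.log (q (J x))) μ :=
    (hJ.integrable_comp_emb hemb (g := fun x => q x * Real.log (q x))).2 h1
  have i5 : Integrable (fun x => q x * Real.log (b (J x))) μ := by
    have h := (hJ.integrable_comp_emb hemb (g := fun x => q (J x) * Real.log (b x))).2 h4
    refine h.congr (Filter.Eventually.of_forall fun x => ?_)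
    simp [Function.comp, hJ2]
  have eP : bookedProduction μ J q b
      = (∫ x, q x * Real.log (b x) ∂μ) - ∫ x, q x * Real.log (b (J x)) ∂μ := by
    unfold bookedProduction
    rw [← integral_sub h2 i5]
    congr 1; ext x; ring
  have eA : asymmetryInfo μ J q
      = (∫ x, q (J x) * Real.log (q (J x)) ∂μ) - ∫ x, q (J x) * Real.log (q x) ∂μ := by
    unfold asymmetryInfo
    rw [← integral_sub i1 h3]
    congr 1; ext x; ring
  have i34 : Integrable (fun x => q (J x) * Real.log (q x) - q (J x) * Real.log (b x)) μ :=
    h3.sub h4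
  have i12 : Integrable (fun x => q x * Real.log (q x) - q x * Real.log (b x)) μ := h1.sub h2
  have eX : oddLogCorrelation μ J q b
      = ((∫ x, q (J x) * Real.log (q x) ∂μ) - ∫ x, q (J x) * Real.log (b x) ∂μ)
        - ((∫ x, q x * Real.log (q x) ∂μ) - ∫ x, q x * Real.log (b x) ∂μ) := by
    unfold oddLogCorrelation
    have e1 : (fun x => (q (J x) - q x) * (Real.log (q x) - Real.log (b x)))
        = fun x => (q (J x) * Real.log (q x) - q (J x) * Real.log (b x))
            - (q x * Real.log (q x) - q x * Real.log (b x)) := by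
      ext x; ring
    rw [e1, integral_sub i34 i12, integral_sub h3 h4, integral_sub h1 h2]
  rw [eP, eA, eX, T1, T2]
  ring

/-- The Jeffreys integrand integrates to twice the asymmetry information: `∫ (qJ − q)(log qJ − log q) = 2 KL(QJ‖Q)`
(for an involution `KL(QJ‖Q) = KL(Q‖QJ)`). -/
theorem integral_jeffreysIntegrand
    (hJ : MeasurePreserving J μ μ) (hJJ : Involutive J)
    (h1 : Integrable (fun x => q x * Real.log (q x)) μ)
    (h3 : Integrable (fun x => q (J x) * Real.log (q x)) μ) :
    ∫ x, jeffreysIntegrand J q x ∂μ = 2 * asymmetryInfo μ J q := by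
  have hJ2 : ∀ x, J (J x) = x := hJJ
  have hemb : MeasurableEmbedding J :=
    (MeasurableEquiv.ofInvolutive J hJJ hJ.measurable).measurableEmbedding
  have i1 : Integrable (fun x => q (J x) * Real.log (q (J x))) μ :=
    (hJ.integrable_comp_emb hemb (g := fun x => q x * Real.log (q x))).2 h1
  have i6 : Integrable (fun x => q x * Real.log (q (J x))) μ := by
    have h := (hJ.integrable_comp_emb hemb (g := fun x => q (J x) * Real.log (q x))).2 h3
    refine h.congr (Filter.Eventually.of_forall fun x => ?_)
    simp [Function.comp, hJ2]
  -- `∫ q (log qJ − log q) = −A` by transport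
  have T : ∫ x, q x * Real.log (q (J x)) ∂μ = ∫ x, q (J x) * Real.log (q x) ∂μ := by
    have h := hJ.integral_comp hemb (fun x => q (J x) * Real.log (q x))
    simp only [hJ2] at h
    exact h
  have e1 : (fun x => jeffreysIntegrand J q x)
      = fun x => (q (J x) * Real.log (q (J x)) - q (J x) * Real.log (q x))
          - (q x * Real.log (q (J x)) - q x * Real.log (q x)) := by
    ext x; unfold jeffreysIntegrand; ring
  have hsplit : ∫ x, ((q (J x) * Real.log (q (J x)) - q (J x) * Real.log (q x))
      - (q x * Real.log (q (J x)) - q x * Real.log (q x))) ∂μ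
      = ((∫ x, q (J x) * Real.log (q (J x)) ∂μ) - ∫ x, q (J x) * Real.log (q x) ∂μ)
        - ((∫ x, q x * Real.log (q (J x)) ∂μ) - ∫ x, q x * Real.log (q x) ∂μ) := by
    have hA1 : ∫ x, (q (J x) * Real.log (q (J x)) - q (J x) * Real.log (q x)) ∂μ
        = (∫ x, q (J x) * Real.log (q (J x)) ∂μ) - ∫ x, q (J x) * Real.log (q x) ∂μ :=
      integral_sub i1 h3
    have hA2 : ∫ x, (q x * Real.log (q (J x)) - q x * Real.log (q x)) ∂μ
        = (∫ x, q x * Real.log (q (J x)) ∂μ) - ∫ x, q x * Real.log (q x) ∂μ :=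
      integral_sub i6 h1
    have hA3 : ∫ x, ((q (J x) * Real.log (q (J x)) - q (J x) * Real.log (q x))
        - (q x * Real.log (q (J x)) - q x * Real.log (q x))) ∂μ
        = (∫ x, (q (J x) * Real.log (q (J x)) - q (J x) * Real.log (q x)) ∂μ)
          - ∫ x, (q x * Real.log (q (J x)) - q x * Real.log (q x)) ∂μ :=
      integral_sub (i1.sub h3) (i6.sub h1)
    rw [hA3, hA1, hA2]
  rw [e1, hsplit, T]
  have eA : asymmetryInfo μ J q
      = (∫ x, q (J x) * Real.log (q (J x)) ∂μ) - ∫ x, q (J x) * Real.log (q x) ∂μ := by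
    unfold asymmetryInfo
    rw [← integral_sub i1 h3]
    congr 1; ext x; ring
  have T1 : ∫ x, q (J x) * Real.log (q (J x)) ∂μ = ∫ x, q x * Real.log (q x) ∂μ :=
    hJ.integral_comp hemb (fun x => q x * Real.log (q x))
  rw [eA, T1]
  ring

/-- The odd log-correlation term only sees the J-ODD part of the log pair-correlation:
`∫ (qJ − q) ψ = ∫ (qJ − q) ψ_odd` (the J-even part integrates to zero by transport). -/
theorem oddLogCorrelation_eq_integral_oddPart
    (hJ : MeasurePreserving J μ μ) (hJJ : Involutive J)
    (h1 : Integrable (fun x => q x * Real.log (q x)) μ)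
    (h2 : Integrable (fun x => q x * Real.log (b x)) μ)
    (h3 : Integrable (fun x => q (J x) * Real.log (q x)) μ)
    (h4 : Integrable (fun x => q (J x) * Real.log (b x)) μ) :
    oddLogCorrelation μ J q b = ∫ x, (q (J x) - q x) * oddPart J (logCorr q b) x ∂μ := by
  have hJ2 : ∀ x, J (J x) = x := hJJ
  have hemb : MeasurableEmbedding J :=
    (MeasurableEquiv.ofInvolutive J hJJ hJ.measurable).measurableEmbedding
  -- the full integrand and its transport
  set F : X → ℝ := fun x => (q (J x) - q x) * logCorr q b x with hF
  have iF : Integrable F μ := by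
    have : F = fun x => (q (J x) * Real.log (q x) - q (J x) * Real.log (b x))
        - (q x * Real.log (q x) - q x * Real.log (b x)) := by
      ext x; simp only [hF, logCorr]; ring
    rw [this]; exact (h3.sub h4).sub (h1.sub h2)
  have iFJ : Integrable (fun x => F (J x)) μ := (hJ.integrable_comp_emb hemb (g := F)).2 iF
  have TF : ∫ x, F (J x) ∂μ = ∫ x, F x ∂μ := hJ.integral_comp hemb F
  have hFJ : ∀ x, F (J x) = -((q (J x) - q x) * logCorr q b (J x)) := by
    intro x; simp only [hF, hJ2]; ring
  have key : (fun x => (q (J x) - q x) * oddPart J (logCorr q b) x)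
      = fun x => (F x + F (J x)) / 2 := by
    ext x; rw [hFJ]; simp only [hF, oddPart]; ring
  rw [key, integral_div, integral_add iF iFJ, TF]
  unfold oddLogCorrelation
  simp only [hF, logCorr]
  ring

omit [MeasurableSpace X] in
/-- **Gibbs sign, pointwise form**: if `q` and `q ∘ J` are non-negative and vanish together, the Jeffreys integrand
is non-negative (monotonicity of `log`; the junk `log 0 = 0` only meets `0 · _`). -/
theorem jeffreysIntegrand_nonneg {x : X} (hq : 0 ≤ q x) (hqJ : 0 ≤ q (J x))
    (hzero : q x = 0 ↔ q (J x) = 0) : 0 ≤ jeffreysIntegrand J q x := by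
  unfold jeffreysIntegrand
  rcases eq_or_lt_of_le hq with h0 | hpos
  · have hJ0 : q (J x) = 0 := hzero.1 h0.symm
    rw [← h0, hJ0]; simp
  · have hJpos : 0 < q (J x) := by
      rcases eq_or_lt_of_le hqJ with h | h
      · exact absurd (hzero.2 h.symm) hpos.ne'
      · exact h
    rcases le_total (q x) (q (J x)) with hle | hle
    · exact mul_nonneg (sub_nonneg.2 hle) (sub_nonneg.2 (Real.log_le_log hpos hle))
    · exact mul_nonneg_of_nonpos_of_nonpos (sub_nonpos.2 hle)
        (sub_nonpos.2 (Real.log_le_log hJpos hle))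

/-- **The odd log-correlation from POINTWISE one-sided relative odd chaos**: the `μ`-preserving involution, the four
integrabilities and K1 — a.e. `(qJ − q)·ψ_odd ≥ −κ·(Jeffreys integrand)/2 − e` with `e` integrable — give
`oddLogCorrelation ≥ −κ·KL(QJ‖Q) − ∫e`.  (No positivity and no restriction on `κ` needed here.) -/
theorem oddLogCorrelation_ge_of_pointwise
    (hJ : MeasurePreserving J μ μ) (hJJ : Involutive J)
    (h1 : Integrable (fun x => q x * Real.log (q x)) μ)
    (h2 : Integrable (fun x => q x * Real.log (b x)) μ)
    (h3 : Integrable (fun x => q (J x) * Real.log (q x)) μ)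
    (h4 : Integrable (fun x => q (J x) * Real.log (b x)) μ)
    {κ : ℝ} {e : X → ℝ} (he : Integrable e μ)
    (hK1 : ∀ᵐ x ∂μ, -(κ * (jeffreysIntegrand J q x / 2)) - e x ≤
      (q (J x) - q x) * oddPart J (logCorr q b) x) :
    -(κ * asymmetryInfo μ J q) - ∫ x, e x ∂μ ≤ oddLogCorrelation μ J q b := by
  have hJ2 : ∀ x, J (J x) = x := hJJ
  have hemb : MeasurableEmbedding J :=
    (MeasurableEquiv.ofInvolutive J hJJ hJ.measurable).measurableEmbedding
  -- integrability of the Jeffreys integrand and of the odd-part integrand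
  have i1 : Integrable (fun x => q (J x) * Real.log (q (J x))) μ :=
    (hJ.integrable_comp_emb hemb (g := fun x => q x * Real.log (q x))).2 h1
  have i6 : Integrable (fun x => q x * Real.log (q (J x))) μ := by
    have h := (hJ.integrable_comp_emb hemb (g := fun x => q (J x) * Real.log (q x))).2 h3
    refine h.congr (Filter.Eventually.of_forall fun x => ?_)
    simp [Function.comp, hJ2]
  have iJeff : Integrable (fun x => jeffreysIntegrand J q x) μ := by
    have : (fun x => jeffreysIntegrand J q x)
        = fun x => (q (J x) * Real.log (q (J x)) - q (J x) * Real.log (q x))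
            - (q x * Real.log (q (J x)) - q x * Real.log (q x)) := by
      ext x; unfold jeffreysIntegrand; ring
    rw [this]; exact (i1.sub h3).sub (i6.sub h1)
  set F : X → ℝ := fun x => (q (J x) - q x) * logCorr q b x with hF
  have iF : Integrable F μ := by
    have : F = fun x => (q (J x) * Real.log (q x) - q (J x) * Real.log (b x))
        - (q x * Real.log (q x) - q x * Real.log (b x)) := by
      ext x; simp only [hF, logCorr]; ring
    rw [this]; exact (h3.sub h4).sub (h1.sub h2)
  have iFJ : Integrable (fun x => F (J x)) μ := (hJ.integrable_comp_emb hemb (g := F)).2 iF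
  have hFJ : ∀ x, F (J x) = -((q (J x) - q x) * logCorr q b (J x)) := by
    intro x; simp only [hF, hJ2]; ring
  have iOdd : Integrable (fun x => (q (J x) - q x) * oddPart J (logCorr q b) x) μ := by
    have key : (fun x => (q (J x) - q x) * oddPart J (logCorr q b) x)
        = fun x => (F x + F (J x)) / 2 := by
      ext x; rw [hFJ]; simp only [hF, oddPart]; ring
    rw [key]; exact (iF.add iFJ).div_const 2
  have hJeff := integral_jeffreysIntegrand hJ hJJ h1 h3
  have hX := oddLogCorrelation_eq_integral_oddPart hJ hJJ h1 h2 h3 h4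
  rw [hX]
  have hneg : Integrable (fun x => -(κ * (jeffreysIntegrand J q x / 2))) μ :=
    ((iJeff.div_const 2).const_mul κ).neg
  have hint : Integrable (fun x => -(κ * (jeffreysIntegrand J q x / 2)) - e x) μ := hneg.sub he
  have hmono := integral_mono_ae hint iOdd hK1
  have hcalc : ∫ x, (-(κ * (jeffreysIntegrand J q x / 2)) - e x) ∂μ
      = -(κ * asymmetryInfo μ J q) - ∫ x, e x ∂μ := by
    have hs : ∫ x, (-(κ * (jeffreysIntegrand J q x / 2)) - e x) ∂μ
        = (∫ x, -(κ * (jeffreysIntegrand J q x / 2)) ∂μ) - ∫ x, e x ∂μ := integral_sub hneg he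
    have hn : ∫ x, -(κ * (jeffreysIntegrand J q x / 2)) ∂μ = -(∫ x, κ * (jeffreysIntegrand J q x / 2) ∂μ) :=
      integral_neg _
    have hm : ∫ x, κ * (jeffreysIntegrand J q x / 2) ∂μ = κ * ∫ x, jeffreysIntegrand J q x / 2 ∂μ :=
      integral_const_mul _ _
    have hd : ∫ x, jeffreysIntegrand J q x / 2 ∂μ = (∫ x, jeffreysIntegrand J q x ∂μ) / 2 :=
      integral_div _ _
    rw [hs, hn, hm, hd, hJeff]
    ring
  rw [hcalc] at hmono
  exact hmono

/-- **Gibbs sign for the asymmetry information**: `0 ≤ KL(QJ‖Q)` from the pointwise Gibbs condition (`q`, `q∘J`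
non-negative and vanishing together a.e.) — no global positivity `∀ x, 0 < q x` is assumed (TRIAGE r2-3 (e): that hypothesis
of the ideator's lemma fails off the incoming set). -/
theorem asymmetryInfo_nonneg_of_ae
    (hJ : MeasurePreserving J μ μ) (hJJ : Involutive J)
    (h1 : Integrable (fun x => q x * Real.log (q x)) μ)
    (h3 : Integrable (fun x => q (J x) * Real.log (q x)) μ)
    (hq : ∀ᵐ x ∂μ, 0 ≤ q x ∧ (q x = 0 ↔ q (J x) = 0)) :
    0 ≤ asymmetryInfo μ J q := by
  have hJeff := integral_jeffreysIntegrand hJ hJJ h1 h3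
  have hqJ : ∀ᵐ x ∂μ, 0 ≤ q (J x) ∧ (q (J x) = 0 ↔ q (J (J x)) = 0) :=
    hJ.quasiMeasurePreserving.tendsto_ae.eventually hq
  have hnn : 0 ≤ ∫ x, jeffreysIntegrand J q x ∂μ := by
    refine integral_nonneg_of_ae ?_
    filter_upwards [hq, hqJ] with x hx hxJ
    exact jeffreysIntegrand_nonneg hx.1 hxJ.1 hx.2
  nlinarith [hJeff]

/-- **The sign from POINTWISE one-sided relative odd chaos** (the composition's use of K1): with `κ ≤ 1`,
`bookedProduction ≥ (1 − κ)·KL(QJ‖Q) − ∫e ≥ −∫ e`. -/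
theorem bookedProduction_ge_of_pointwise
    (hJ : MeasurePreserving J μ μ) (hJJ : Involutive J)
    (h1 : Integrable (fun x => q x * Real.log (q x)) μ)
    (h2 : Integrable (fun x => q x * Real.log (b x)) μ)
    (h3 : Integrable (fun x => q (J x) * Real.log (q x)) μ)
    (h4 : Integrable (fun x => q (J x) * Real.log (b x)) μ)
    (hq : ∀ᵐ x ∂μ, 0 ≤ q x ∧ (q x = 0 ↔ q (J x) = 0))
    {κ : ℝ} (hκ : κ ≤ 1) {e : X → ℝ} (he : Integrable e μ)
    (hK1 : ∀ᵐ x ∂μ, -(κ * (jeffreysIntegrand J q x / 2)) - e x ≤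
      (q (J x) - q x) * oddPart J (logCorr q b) x) :
    -(∫ x, e x ∂μ) ≤ bookedProduction μ J q b := by
  have hId := bookedProduction_eq_asymmetryInfo_add_oddLogCorrelation hJ hJJ h1 h2 h3 h4
  have hA := asymmetryInfo_nonneg_of_ae hJ hJJ h1 h3 hq
  have hXge := oddLogCorrelation_ge_of_pointwise hJ hJJ h1 h2 h3 h4 he hK1
  rw [hId]
  nlinarith [hA, hXge, hκ]

/-- **The budget** (K1 read upward — the card's one new implication, conceded by all three triagers): under the same
hypotheses (no positivity, any `κ`), `(1 − κ)·KL(QJ‖Q) ≤ bookedProduction + ∫e`.  Since the booked production is bounded by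
the kinetic-entropy drop, an a-priori quantity, this is the Maxwellisation budget feeding stub M. -/
theorem asymmetryInfo_le_of_pointwise
    (hJ : MeasurePreserving J μ μ) (hJJ : Involutive J)
    (h1 : Integrable (fun x => q x * Real.log (q x)) μ)
    (h2 : Integrable (fun x => q x * Real.log (b x)) μ)
    (h3 : Integrable (fun x => q (J x) * Real.log (q x)) μ)
    (h4 : Integrable (fun x => q (J x) * Real.log (b x)) μ)
    {κ : ℝ} {e : X → ℝ} (he : Integrable e μ)
    (hK1 : ∀ᵐ x ∂μ, -(κ * (jeffreysIntegrand J q x / 2)) - e x ≤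
      (q (J x) - q x) * oddPart J (logCorr q b) x) :
    (1 - κ) * asymmetryInfo μ J q ≤ bookedProduction μ J q b + ∫ x, e x ∂μ := by
  have hId := bookedProduction_eq_asymmetryInfo_add_oddLogCorrelation hJ hJJ h1 h2 h3 h4
  have hXge := oddLogCorrelation_ge_of_pointwise hJ hJJ h1 h2 h3 h4 he hK1
  rw [hId]
  nlinarith [hXge]

end Kernel

universe u

/-- Registered anchor of this vocabulary file (`contactKernel_budget`): the budget `(1 − κ)·KL(QJ‖Q) ≤ bookedProduction + ∫e`
from pointwise one-sided relative odd chaos, as a closed statement. -/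
theorem contactKernel_budget : ∀ {X : Type u} [MeasurableSpace X] {μ : Measure X} {J : X → X} {q b : X → ℝ}, MeasurePreserving J μ μ → Involutive J → Integrable (fun x => q x * Real.log (q x)) μ → Integrable (fun x => q x * Real.log (b x)) μ → Integrable (fun x => q (J x) * Real.log (q x)) μ → Integrable (fun x => q (J x) * Real.log (b x)) μ → ∀ (κ : ℝ) (e : X → ℝ), Integrable e μ → (∀ᵐ x ∂μ, -(κ * (jeffreysIntegrand J q x / 2)) - e x ≤ (q (J x) - q x) * oddPart J (logCorr q b) x) → (1 - κ) * asymmetryInfo μ J q ≤ bookedProduction μ J q b + ∫ x, e x ∂μ :=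
  fun hJ hJJ h1 h2 h3 h4 _ _ he hK1 => asymmetryInfo_le_of_pointwise hJ hJJ h1 h2 h3 h4 he hK1

end Summit.AtomisticToContinuum.HydrodynamicLimit.Theorems.LocalSecondLawContact

end
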